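import Summits.AtomisticToContinuum.FouriersLaw.Theses.BondHeatUncertainty
import Summits.AtomisticToContinuum.FouriersLaw.Theorems.BondHeatUncertaintySubdiffusiveBondHeatGibbsPositionEighthMomentRearrangement

/-!
# Transfer recursion for the one-site marginals of the configurational Gibbs weight

Helper file for the registered stub `stub_gibbsPositionEighthMoment` of line
`bath-bond-deficit-integral`, crux `BondHeatUncertainty.SubdiffusiveBondHeat`
(item `stmt-AtomisticToContinuum-9120`).

For an `OscillatorChain P` with continuous, radially non-decreasing pinning `U` and coupling `V`
(`|a| ≤ |b| → U a ≤ U b`, same for `V`; e.g. `pinnedChain ω₂ lam β γ` with `ω₂, lam, β ≥ 0`) and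
`T ≥ 0`, consider the configurational Gibbs weight `w_N(q) = e^{-Φ_N(q)/T}` on `Fin N → ℝ`
(`Φ_N = OscillatorChain.potential`, so that `e^{-H/T} = e^{-∑p²/(2T)} w_N(q)`), as an
`ℝ≥0∞`-valued function integrated against Lebesgue measure (lower integrals throughout: no
integrability bookkeeping).

* `potential_one`, `potential_cons_succ` — the transfer structure of the potential energy:
  `Φ₁(q) = U(q₀)` and `Φ_{n+2}(a :: q) = U(a) + V(q₀ - a) + Φ_{n+1}(q)`;
* `lintegral_fin_succ_eq_cons` — integrating out the first coordinate
  (`MeasureTheory.volume_preserving_piFinSuccAbove` + Tonelli);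
* `exists_marginal_factor` — **transfer recursion + Wintner's lemma**: for every `n` the
  unnormalised marginal of `q₀` under `w_{n+1}`, `m_{n+1}(a) = ∫ w_{n+1}(a :: q') dq'`, factors as
  `e^{-U(a)/T} · G(a)` with `G` measurable and radially non-increasing (induction on `n`:
  `G_{n+2}(a) = ∫ m_{n+1}(b) e^{-V(a-b)/T} db` is a convolution of two radially non-increasing
  functions);
* `lintegral_coord_zero_mul_le`, `lintegral_coord_one_mul_le` — **Chebyshev step**: for every
  measurable radially non-decreasing `h : ℝ → ℝ≥0∞` (e.g. `h(a) = a⁸`),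
  `(∫ h(q_i) w_N(q) dq) · (∫ e^{-U/T}) ≤ (∫ h e^{-U/T}) · (∫ w_N)` for `i = 0` (`N ≥ 1`) and
  `i = 1` (`N ≥ 2`; the marginal of `q₁` is `e^{-U/T}` times the product of the left factor
  `∫ e^{-U(a)/T} e^{-V(· - a)/T} da` and the right factor `G`, both radially non-increasing),
  i.e. `E_N[h(q_i)] ≤ ∫ h e^{-U/T} / ∫ e^{-U/T}` uniformly in `N`.

Everything is elementary and tagged folklore (transfer-operator folklore for one-dimensional
Gibbs states; Wintner 1938; Hardy–Littlewood–Pólya Thm 43).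
-/

noncomputable section

open MeasureTheory Set
open scoped ENNReal

namespace Summit.AtomisticToContinuum.FouriersLaw.Theorems.SubdiffusiveBondHeat

open Literature.MathematicalPhysics.KineticTheory.HeatConduction

/-! ## The transfer structure of the potential energy -/

section Potential

variable (P : OscillatorChain)

/-- One site: `Φ₁(q) = U(q₀)` (no bond). [folklore] -/
theorem potential_one (q : Fin 1 → ℝ) : P.potential 1 q = P.U (q 0) := by
  simp [OscillatorChain.potential]

/-- Transfer recursion of the potential energy: splitting off the first site of an
`(n+2)`-site chain, `Φ_{n+2}(a :: q) = U(a) + V(q₀ - a) + Φ_{n+1}(q)`. [folklore] -/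
theorem potential_cons_succ (n : ℕ) (a : ℝ) (q : Fin (n + 1) → ℝ) :
    P.potential (n + 2) (Fin.cons a q) = P.U a + P.V (q 0 - a) + P.potential (n + 1) q := by
  have hA : (∑ j : Fin (n + 2), if (j : ℕ) = ((0 : Fin (n + 2)) : ℕ) + 1 then
      P.V ((Fin.cons a q : Fin (n + 2) → ℝ) j - a) else 0) = P.V (q 0 - a) := by
    rw [Finset.sum_eq_single (1 : Fin (n + 2))]
    · rfl
    · intro b _ hb
      rw [if_neg]
      intro h
      exact hb (Fin.ext h)
    · intro h
      exact absurd (Finset.mem_univ _) h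
  have hB : ∀ i : Fin (n + 1), (∑ j : Fin (n + 2), if (j : ℕ) = (i.succ : ℕ) + 1 then
      P.V ((Fin.cons a q : Fin (n + 2) → ℝ) j - q i) else 0) =
        ∑ j : Fin (n + 1), if (j : ℕ) = (i : ℕ) + 1 then P.V (q j - q i) else 0 := by
    intro i
    rw [Fin.sum_univ_succ]
    simp only [Fin.val_zero, Fin.val_succ, Fin.cons_zero, Fin.cons_succ, add_left_inj]
    simp
  simp only [OscillatorChain.potential]
  rw [Fin.sum_univ_succ, Fin.sum_univ_succ (n := n + 1)]
  simp only [Fin.cons_zero, Fin.cons_succ]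
  rw [hA, Finset.sum_congr rfl fun i _ => hB i]
  ring

/-- The potential energy is continuous when the potentials are. [folklore] -/
theorem continuous_potential (hU : Continuous P.U) (hV : Continuous P.V) (N : ℕ) :
    Continuous (P.potential N) := by
  have h : P.potential N = fun q => P.hamiltonian N (q, 0) := by
    funext q
    simp [P.hamiltonian_eq_kinetic_add_potential]
  rw [h]
  exact (P.continuous_hamiltonian hU hV N).comp (by fun_prop)

/-- The weight factorises along the transfer recursion:
`e^{-Φ_{n+2}(a :: q)/T} = e^{-U(a)/T} · (e^{-V(q₀ - a)/T} · e^{-Φ_{n+1}(q)/T})`. [folklore] -/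
theorem ofReal_exp_neg_potential_cons_succ (n : ℕ) (T : ℝ) (a : ℝ) (q : Fin (n + 1) → ℝ) :
    ENNReal.ofReal (Real.exp (-P.potential (n + 2) (Fin.cons a q) / T)) =
      ENNReal.ofReal (Real.exp (-P.U a / T)) * (ENNReal.ofReal (Real.exp (-P.V (q 0 - a) / T)) *
        ENNReal.ofReal (Real.exp (-P.potential (n + 1) q / T))) := by
  rw [potential_cons_succ, ← ENNReal.ofReal_mul (Real.exp_nonneg _),
    ← ENNReal.ofReal_mul (Real.exp_nonneg _), ← Real.exp_add, ← Real.exp_add]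
  congr 2
  ring

end Potential

/-! ## Integrating out the first coordinate -/

/-- `(a, q') ↦ a :: q'` is measurable (it is the inverse of the measurable equivalence
`MeasurableEquiv.piFinSuccAbove _ 0`). [folklore] -/
theorem measurable_finCons (n : ℕ) :
    Measurable fun x : ℝ × (Fin n → ℝ) => (Fin.cons x.1 x.2 : Fin (n + 1) → ℝ) := by
  convert (MeasurableEquiv.piFinSuccAbove (fun _ : Fin (n + 1) => ℝ) 0).symm.measurable using 1
  funext x
  simp [MeasurableEquiv.piFinSuccAbove_symm_apply, Fin.insertNthEquiv, Fin.insertNth_zero']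

/-- Compositional form of `measurable_finCons` for `fun_prop`. [folklore] -/
@[fun_prop]
theorem Measurable.finCons {α : Type*} [MeasurableSpace α] (n : ℕ) {f : α → ℝ}
    {g : α → (Fin n → ℝ)} (hf : Measurable f) (hg : Measurable g) :
    Measurable fun x => (Fin.cons (f x) (g x) : Fin (n + 1) → ℝ) :=
  (measurable_finCons n).comp (hf.prodMk hg)

/-- Integrating out all coordinates but the first (Lebesgue measure on `Fin (n+1) → ℝ` is the
product of Lebesgue measure on the first coordinate and on the remaining `n`; Tonelli).
[folklore] -/
theorem lintegral_fin_succ_eq_cons :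
    ∀ (n : ℕ) {F : (Fin (n + 1) → ℝ) → ENNReal}, Measurable F →
      ∫⁻ q, F q = ∫⁻ a : ℝ, ∫⁻ q : Fin n → ℝ, F (Fin.cons a q) := by
  intro n F hF
  have hmp := (volume_preserving_piFinSuccAbove (fun _ : Fin (n + 1) => ℝ) 0).symm
  rw [← hmp.lintegral_comp_emb (MeasurableEquiv.measurableEmbedding _),
    Measure.volume_eq_prod, lintegral_prod]
  · simp [MeasurableEquiv.piFinSuccAbove_symm_apply, Fin.insertNthEquiv, Fin.insertNth_zero']
  · exact (hF.comp (MeasurableEquiv.measurable _)).aemeasurable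

/-! ## Transfer recursion: the marginal of `q₀` is `e^{-U/T}` times a radially non-increasing factor -/

section Transfer

variable {P : OscillatorChain} (hUc : Continuous P.U) (hVc : Continuous P.V)
  (hU : ∀ ⦃a b : ℝ⦄, |a| ≤ |b| → P.U a ≤ P.U b) (hV : ∀ ⦃a b : ℝ⦄, |a| ≤ |b| → P.V a ≤ P.V b)
  {T : ℝ} (hT : 0 ≤ T)

include hUc hVc hU hV hT

/-- **Transfer recursion + Wintner's lemma.** For every `n`, the unnormalised marginal of the
first coordinate under the configurational Gibbs weight of the `(n+1)`-site chain factorises as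
`∫ e^{-Φ_{n+1}(a :: q')/T} dq' = e^{-U(a)/T} · G(a)` with `G` measurable and radially
non-increasing (`G₁ = 1`; `G_{n+2}(a) = ∫ e^{-U(b)/T} G_{n+1}(b) e^{-V(a-b)/T} db`, a convolution
of two radially non-increasing functions). [folklore] -/
theorem exists_marginal_factor (n : ℕ) :
    ∃ G : ℝ → ℝ≥0∞, Measurable G ∧ (∀ ⦃a b : ℝ⦄, |a| ≤ |b| → G b ≤ G a) ∧
      ∀ a : ℝ, ∫⁻ q : Fin n → ℝ, ENNReal.ofReal (Real.exp (-P.potential (n + 1) (Fin.cons a q) / T)) =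
        ENNReal.ofReal (Real.exp (-P.U a / T)) * G a := by
  have hUm : Measurable P.U := hUc.measurable
  have hVm : Measurable P.V := hVc.measurable
  induction n with
  | zero =>
    refine ⟨fun _ => 1, measurable_const, fun _ _ _ => le_rfl, fun a => ?_⟩
    have h0 : ∀ q : Fin 0 → ℝ, P.potential 1 (Fin.cons a q) = P.U a := fun q => by
      rw [potential_one]; rfl
    simp_rw [h0]
    rw [lintegral_const, volume_pi, Measure.pi_empty_univ, mul_one]
  | succ n ih =>
    obtain ⟨G, hGm, hGa, hG⟩ := ih
    have hΦ : Measurable (P.potential (n + 1)) := (continuous_potential P hUc hVc _).measurable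
    have hea := radAnti_ofReal_exp_neg_div hU hT
    have hga := radAnti_ofReal_exp_neg_div hV hT
    refine ⟨fun a => ∫⁻ b, ENNReal.ofReal (Real.exp (-P.U b / T)) * G b *
      ENNReal.ofReal (Real.exp (-P.V (a - b) / T)), ?_, ?_, fun a => ?_⟩
    · exact Measurable.lintegral_prod_right (by fun_prop)
    · exact radAnti_lintegral_mul_sub (by fun_prop) (by fun_prop) (radAnti_mul hea hGa) hga
    · calc ∫⁻ q : Fin (n + 1) → ℝ,
            ENNReal.ofReal (Real.exp (-P.potential (n + 2) (Fin.cons a q) / T))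
          = ∫⁻ q : Fin (n + 1) → ℝ, ENNReal.ofReal (Real.exp (-P.U a / T)) *
              (ENNReal.ofReal (Real.exp (-P.V (q 0 - a) / T)) *
                ENNReal.ofReal (Real.exp (-P.potential (n + 1) q / T))) :=
            lintegral_congr fun q => ofReal_exp_neg_potential_cons_succ P n T a q
        _ = ENNReal.ofReal (Real.exp (-P.U a / T)) * ∫⁻ b, ∫⁻ q : Fin n → ℝ,
              ENNReal.ofReal (Real.exp (-P.V (b - a) / T)) *
                ENNReal.ofReal (Real.exp (-P.potential (n + 1) (Fin.cons b q) / T)) := by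
            rw [lintegral_const_mul' _ _ ENNReal.ofReal_ne_top, lintegral_fin_succ_eq_cons n
              (show Measurable (fun q : Fin (n + 1) → ℝ =>
                ENNReal.ofReal (Real.exp (-P.V (q 0 - a) / T)) *
                  ENNReal.ofReal (Real.exp (-P.potential (n + 1) q / T))) by fun_prop)]
            rfl
        _ = ENNReal.ofReal (Real.exp (-P.U a / T)) * ∫⁻ b,
              ENNReal.ofReal (Real.exp (-P.V (b - a) / T)) *
                (ENNReal.ofReal (Real.exp (-P.U b / T)) * G b) := by
            congr 1
            refine lintegral_congr fun b => ?_
            rw [lintegral_const_mul' _ _ ENNReal.ofReal_ne_top, hG b]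
        _ = _ := by
            congr 1
            refine lintegral_congr fun b => ?_
            rw [radAnti_eq hga (abs_sub_comm b a)]
            ring

/-- **Chebyshev step at site `0`.** For `N = n+1 ≥ 1` sites and every measurable radially
non-decreasing `h : ℝ → ℝ≥0∞`:
`(∫ h(q₀) e^{-Φ_N(q)/T} dq)(∫ e^{-U(a)/T} da) ≤ (∫ h(a) e^{-U(a)/T} da)(∫ e^{-Φ_N(q)/T} dq)`, i.e.
`E_N[h(q₀)] ≤ ∫ h e^{-U/T} / ∫ e^{-U/T}`: the marginal of `q₀` is `e^{-U/T} G` with `G` radially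
non-increasing (`exists_marginal_factor`), and Chebyshev's covariance inequality applies.
[folklore] -/
theorem lintegral_coord_zero_mul_le (n : ℕ) {h : ℝ → ℝ≥0∞} (hh : Measurable h)
    (hhm : ∀ ⦃a b : ℝ⦄, |a| ≤ |b| → h a ≤ h b) :
    (∫⁻ q : Fin (n + 1) → ℝ, h (q 0) * ENNReal.ofReal (Real.exp (-P.potential (n + 1) q / T))) *
        ∫⁻ a, ENNReal.ofReal (Real.exp (-P.U a / T)) ≤
      (∫⁻ a, h a * ENNReal.ofReal (Real.exp (-P.U a / T))) *
        ∫⁻ q : Fin (n + 1) → ℝ, ENNReal.ofReal (Real.exp (-P.potential (n + 1) q / T)) := by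
  obtain ⟨G, hGm, hGa, hG⟩ := exists_marginal_factor hUc hVc hU hV hT n
  have hUm : Measurable P.U := hUc.measurable
  have hΦ : Measurable (P.potential (n + 1)) := (continuous_potential P hUc hVc _).measurable
  -- reduction of `∫ h'(q₀) w(q) dq` to the marginal, for any measurable `h'`
  have red : ∀ {h' : ℝ → ℝ≥0∞}, Measurable h' →
      ∫⁻ q : Fin (n + 1) → ℝ, h' (q 0) * ENNReal.ofReal (Real.exp (-P.potential (n + 1) q / T)) =
        ∫⁻ a, h' a * G a * ENNReal.ofReal (Real.exp (-P.U a / T)) := by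
    intro h' hh'
    rw [lintegral_fin_succ_eq_cons n (show Measurable (fun q : Fin (n + 1) → ℝ =>
      h' (q 0) * ENNReal.ofReal (Real.exp (-P.potential (n + 1) q / T))) by fun_prop)]
    refine lintegral_congr fun a => ?_
    simp only [Fin.cons_zero]
    rw [lintegral_const_mul'' _ (show Measurable (fun q : Fin n → ℝ =>
      ENNReal.ofReal (Real.exp (-P.potential (n + 1) (Fin.cons a q) / T))) by
        fun_prop).aemeasurable, hG a]
    ring
  have hone : ∫⁻ q : Fin (n + 1) → ℝ, ENNReal.ofReal (Real.exp (-P.potential (n + 1) q / T)) =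
      ∫⁻ a, G a * ENNReal.ofReal (Real.exp (-P.U a / T)) := by
    simpa only [one_mul] using red (h' := fun _ => 1) measurable_const
  rw [red hh, hone]
  exact chebyshev_lintegral (by fun_prop) hh hGm hhm hGa

/-- **Chebyshev step at site `1`.** For `N = n+2 ≥ 2` sites and every measurable radially
non-decreasing `h : ℝ → ℝ≥0∞`:
`(∫ h(q₁) e^{-Φ_N(q)/T} dq)(∫ e^{-U(a)/T} da) ≤ (∫ h(a) e^{-U(a)/T} da)(∫ e^{-Φ_N(q)/T} dq)`:
integrating out `q₀` first and then `q₂, …`, the marginal of `q₁` is `e^{-U(b)/T} L(b) G(b)` with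
the left factor `L(b) = ∫ e^{-U(a)/T} e^{-V(b-a)/T} da` (Wintner) and the right factor `G` of
`exists_marginal_factor`, both radially non-increasing; then Chebyshev. [folklore] -/
theorem lintegral_coord_one_mul_le (n : ℕ) {h : ℝ → ℝ≥0∞} (hh : Measurable h)
    (hhm : ∀ ⦃a b : ℝ⦄, |a| ≤ |b| → h a ≤ h b) :
    (∫⁻ q : Fin (n + 2) → ℝ, h (q 1) * ENNReal.ofReal (Real.exp (-P.potential (n + 2) q / T))) *
        ∫⁻ a, ENNReal.ofReal (Real.exp (-P.U a / T)) ≤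
      (∫⁻ a, h a * ENNReal.ofReal (Real.exp (-P.U a / T))) *
        ∫⁻ q : Fin (n + 2) → ℝ, ENNReal.ofReal (Real.exp (-P.potential (n + 2) q / T)) := by
  obtain ⟨G, hGm, hGa, hG⟩ := exists_marginal_factor hUc hVc hU hV hT n
  have hUm : Measurable P.U := hUc.measurable
  have hVm : Measurable P.V := hVc.measurable
  have hΦ₁ : Measurable (P.potential (n + 1)) := (continuous_potential P hUc hVc _).measurable
  have hΦ₂ : Measurable (P.potential (n + 2)) := (continuous_potential P hUc hVc _).measurable
  have hea := radAnti_ofReal_exp_neg_div hU hT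
  have hga := radAnti_ofReal_exp_neg_div hV hT
  -- the left factor (bath site integrated out): a convolution, radially non-increasing
  set L : ℝ → ℝ≥0∞ := fun b => ∫⁻ a, ENNReal.ofReal (Real.exp (-P.U a / T)) *
    ENNReal.ofReal (Real.exp (-P.V (b - a) / T)) with hL
  have hLm : Measurable L := Measurable.lintegral_prod_right (by fun_prop)
  have hLa : ∀ ⦃a b : ℝ⦄, |a| ≤ |b| → L b ≤ L a :=
    radAnti_lintegral_mul_sub (by fun_prop) (by fun_prop) hea hga
  -- reduction of `∫ h'(q₁) w(q) dq` to the marginal of `q₁`, for any measurable `h'`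
  have red : ∀ {h' : ℝ → ℝ≥0∞}, Measurable h' →
      ∫⁻ q : Fin (n + 2) → ℝ, h' (q 1) * ENNReal.ofReal (Real.exp (-P.potential (n + 2) q / T)) =
        ∫⁻ b, h' b * (L b * G b) * ENNReal.ofReal (Real.exp (-P.U b / T)) := by
    intro h' hh'
    calc ∫⁻ q : Fin (n + 2) → ℝ, h' (q 1) * ENNReal.ofReal (Real.exp (-P.potential (n + 2) q / T))
        = ∫⁻ a, ∫⁻ q : Fin (n + 1) → ℝ, h' (q 0) * (ENNReal.ofReal (Real.exp (-P.U a / T)) *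
            (ENNReal.ofReal (Real.exp (-P.V (q 0 - a) / T)) *
              ENNReal.ofReal (Real.exp (-P.potential (n + 1) q / T)))) := by
          rw [lintegral_fin_succ_eq_cons (n + 1) (show Measurable (fun q : Fin (n + 2) → ℝ =>
            h' (q 1) * ENNReal.ofReal (Real.exp (-P.potential (n + 2) q / T))) by fun_prop)]
          refine lintegral_congr fun a => lintegral_congr fun q => ?_
          rw [ofReal_exp_neg_potential_cons_succ]
          rfl
      _ = ∫⁻ q : Fin (n + 1) → ℝ, ∫⁻ a, h' (q 0) * (ENNReal.ofReal (Real.exp (-P.U a / T)) *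
            (ENNReal.ofReal (Real.exp (-P.V (q 0 - a) / T)) *
              ENNReal.ofReal (Real.exp (-P.potential (n + 1) q / T)))) :=
          lintegral_lintegral_swap (by fun_prop)
      _ = ∫⁻ q : Fin (n + 1) → ℝ, h' (q 0) * L (q 0) *
            ENNReal.ofReal (Real.exp (-P.potential (n + 1) q / T)) := by
          refine lintegral_congr fun q => ?_
          have e : ∀ a, h' (q 0) * (ENNReal.ofReal (Real.exp (-P.U a / T)) *
              (ENNReal.ofReal (Real.exp (-P.V (q 0 - a) / T)) *
                ENNReal.ofReal (Real.exp (-P.potential (n + 1) q / T)))) =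
              ENNReal.ofReal (Real.exp (-P.U a / T)) *
                ENNReal.ofReal (Real.exp (-P.V (q 0 - a) / T)) *
                (h' (q 0) * ENNReal.ofReal (Real.exp (-P.potential (n + 1) q / T))) :=
            fun a => by ring
          simp_rw [e]
          rw [lintegral_mul_const _ (show Measurable (fun a : ℝ =>
            ENNReal.ofReal (Real.exp (-P.U a / T)) *
              ENNReal.ofReal (Real.exp (-P.V (q 0 - a) / T))) by fun_prop)]
          simp only [hL]
          ring
      _ = ∫⁻ b, ∫⁻ q : Fin n → ℝ, h' b * L b *
            ENNReal.ofReal (Real.exp (-P.potential (n + 1) (Fin.cons b q) / T)) := by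
          rw [lintegral_fin_succ_eq_cons n (show Measurable (fun q : Fin (n + 1) → ℝ =>
            h' (q 0) * L (q 0) * ENNReal.ofReal (Real.exp (-P.potential (n + 1) q / T))) by
              fun_prop)]
          rfl
      _ = ∫⁻ b, h' b * (L b * G b) * ENNReal.ofReal (Real.exp (-P.U b / T)) := by
          refine lintegral_congr fun b => ?_
          rw [lintegral_const_mul'' _ (show Measurable (fun q : Fin n → ℝ =>
            ENNReal.ofReal (Real.exp (-P.potential (n + 1) (Fin.cons b q) / T))) by
              fun_prop).aemeasurable, hG b]
          ring
  have hone : ∫⁻ q : Fin (n + 2) → ℝ, ENNReal.ofReal (Real.exp (-P.potential (n + 2) q / T)) =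
      ∫⁻ b, (L b * G b) * ENNReal.ofReal (Real.exp (-P.U b / T)) := by
    simpa only [one_mul] using red (h' := fun _ => 1) measurable_const
  rw [red hh, hone]
  exact chebyshev_lintegral (by fun_prop) hh (hLm.mul hGm) hhm (radAnti_mul hLa hGa)

end Transfer

end Summit.AtomisticToContinuum.FouriersLaw.Theorems.SubdiffusiveBondHeat
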